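import Mathlib
import Summits.Ventures.HodgeRepro.Tier4.Line4.VanishingOfOrthogonal
import Summits.Ventures.HodgeRepro.Tier4.Line4.W3OfRieszType
import Summits.Ventures.HodgeRepro.Tier4.Line4.ConjSpanLemmas

/-!
# Tier4/Line4/VanishingClause — the clause `hvan` of the re-typed L4 residual is a THEOREM for every test function
`f₁` RIGHT-equivariant under the local tori of `T′` and right-invariant under the level `K`

Blind re-derivation cell `pub-hodge-repro`, Tier 4 «prove the step» (README §9–§10), seat t4-L4-p2 (prover, LINE L4,
gen 3; bus S13854 / S13909). Tree path `lean/Summits/Ventures/HodgeRepro/Tier4/Line4/VanishingClause.lean`.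
Mathlib-level; no literature.  Inputs: this seat's `Line4/VanishingOfOrthogonal` (p686709: `R(f₁)` kills the orthogonal
complement of any space into which `R(f₁*)` maps), t4-L4-p1's `Line4/W3OfRieszType.rightRegular_mem_kTypeSpace'`
(`R(f)` of a left-`(τ′,K)`-equivariant test function lands in `kTypeSpace'`) and `Line4/ConjSpanLemmas`
(`coe_span_eq_of_isInvariantSubspace`).

WHAT IS PROVED.  `hvan_of_right_equivariant`: for a test function `f₁` with `f₁ (z κ) = conj (weight′ κ) · f₁ z` for
`κ ∈ localTorusAt' W w` (every infinite place `w`, the weights `(eP′ w, eM′ w)`) and `f₁ (z κ) = f₁ z` for `κ ∈ K`, the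
clause `hvan` of t4-L4-p1's `W3OfRieszType.mixed_two_torus_W3R_of_adapted` (the residual of the re-typed wall, L4 v0.22)
holds VERBATIM: for every non-zero irreducible invariant `U` and every `ψ ∈ U` orthogonal to
`kTypeSpace' W q g g' eP' eM' K (span ℂ U)`, `R(f̄₁)(conj ∘ ψ) = 0`.  Mechanism: `f₁* = cj (refl f₁)` is then
LEFT-`(τ′,K)`-equivariant (`(cj (refl f₁)) (κ⁻¹ y) = conj (f₁ (y⁻¹ κ))`), so `R(f₁*)` maps `U` into the `K`-type space
of `span ℂ U` (`rightRegular_mem_kTypeSpace'`), and the adjoint identity does the rest (`VanishingOfOrthogonal`).  The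
right-equivariant test functions are exactly what typer-2's `Common/KTypeProjector` (`kProj`, `kProj_apply_mul`) and
`KTypeProjectorCompose` produce from any test function (`f₁ := e_{T′_{w}, conj weight′} ⋆ e_K ⋆ f`), so after this module
the clause `hvan` is no longer displayed data of the residual: it is the choice of `f₁` in that class.  What stays:
`ha`/`hb` (multiplicity one), `hadm`, `hfin` (printed) and `hJ` (the weak W5 for the pair).

Nothing here says anything about the status of the Hodge conjecture for CM abelian varieties, which is NOT proved
(HC_CM is NOT proved by anyone in this repository).
-/

set_option autoImplicit false

noncomputable section

namespace Summit.Ventures.HodgeRepro.Tier4.Line4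

open Summit.Ventures.HodgeRepro.Tier4.Common Summit.Ventures.HodgeRepro.Tier4.Line1
  Summit.Ventures.HodgeRepro.Tier4.Line1.RTF MeasureTheory NumberField
open scoped ComplexConjugate

section Clause

variable {k : Type} [Field k] [NumberField k] (W : PlaneData k) [MeasurableSpace (GA W)] [BorelSpace (GA W)]
  (R : RTFData W) (μ : Measure (GA W)) [μ.IsHaarMeasure] [R.μT.IsHaarMeasure] [R.μT'.IsHaarMeasure]
  (DG : Set (GA W)) (fdG : IsFundamentalDomain (rationalPoints W) DG μ) (compG : IsCompact (closure DG))
  (compT : IsCompact (closure R.DT)) (compT' : IsCompact (closure R.DT'))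

omit [MeasurableSpace (GA W)] [BorelSpace (GA W)] in
/-- The adjoint `f* = cj (refl f)` of a right-equivariant test function is left-equivariant (with the conjugate
weight): `f (z κ) = conj c · f z` for all `z` gives `(cj (refl f)) (κ⁻¹ y) = c · (cj (refl f)) y`. -/
theorem cj_refl_apply_inv_mul {f : GA W → ℂ} {κ : GA W} {c : ℂ} (h : ∀ z, f (z * κ) = conj c * f z) (y : GA W) :
    RTF.cj (RTF.refl f) (κ⁻¹ * y) = c * RTF.cj (RTF.refl f) y := by
  simp only [RTF.cj, RTF.refl, mul_inv_rev, inv_inv]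
  rw [h y⁻¹, map_mul, Complex.conj_conj]

/-- **THE CLAUSE `hvan` FOR RIGHT-`(τ′,K)`-EQUIVARIANT TEST FUNCTIONS**: if `f₁` is a test function with
`f₁ (z κ) = conj (weight′ κ) · f₁ z` on the local tori of `T′` at every infinite place and `f₁ (z κ) = f₁ z` on `K`,
then for every non-zero irreducible invariant `U` and every `ψ ∈ U` orthogonal to `kTypeSpace' … K (span ℂ U)`,
`R(f̄₁)(conj ∘ ψ) = 0` — the clause `hvan` of `mixed_two_torus_W3R_of_adapted` verbatim. -/
theorem hvan_of_right_equivariant (q : QuadData k) (g g' : Matrix (Fin 4) (Fin 4) k)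
    (eP' eM' : InfinitePlace k → ℤ) (K : Subgroup (GA W)) {f₁ : GA W → ℂ} (h₁ : IsTestFn W f₁)
    (hT' : ∀ (w : InfinitePlace k) (κ : GA W), κ ∈ localTorusAt' W w → ∀ z,
      f₁ (z * κ) = conj (weightAt' W q w g g' 0 κ ^ eP' w * weightAt' W q w g g' 1 κ ^ eM' w) * f₁ z)
    (hK : ∀ κ ∈ K, ∀ z, f₁ (z * κ) = f₁ z) :
    ∀ U : Set (GA W → ℂ), (Setting.ofAdelicData W R μ DG fdG compG compT compT').IsIrrNonzero U →
      ∀ ψ ∈ U, (∀ w ∈ kTypeSpace' W q g g' eP' eM' K (Submodule.span ℂ U),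
        (Setting.ofAdelicData W R μ DG fdG compG compT compT').inner ψ w = 0) →
        rightRegular W μ (RTF.cj f₁) (fun x => conj (ψ x)) = fun _ => 0 := by
  intro U hU ψ hψ hperp
  set S := Setting.ofAdelicData W R μ DG fdG compG compT compT' with hS
  have hUinv : S.IsInvariantSubspace U := hU.1
  have hne : U.Nonempty := by
    obtain ⟨ψ₀, hψ₀, -⟩ := hU.2.2
    exact ⟨ψ₀, hψ₀⟩
  have hspan : (Submodule.span ℂ U : Set (GA W → ℂ)) = U := coe_span_eq_of_isInvariantSubspace S hUinv hne
  have hVspan : S.IsInvariantSubspace (Submodule.span ℂ U : Set (GA W → ℂ)) := by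
    rw [hspan]
    exact hUinv
  have hf' : IsTestFn W (RTF.cj (RTF.refl f₁)) :=
    ⟨(RTF.IsTest.cj (RTF.IsTest.refl ⟨h₁.1, h₁.2⟩)).cont, (RTF.IsTest.cj (RTF.IsTest.refl ⟨h₁.1, h₁.2⟩)).compact⟩
  have hT'' : ∀ (w : InfinitePlace k) (κ : GA W), κ ∈ localTorusAt' W w → ∀ y,
      RTF.cj (RTF.refl f₁) (κ⁻¹ * y) =
        weightAt' W q w g g' 0 κ ^ eP' w * weightAt' W q w g g' 1 κ ^ eM' w * RTF.cj (RTF.refl f₁) y :=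
    fun w κ hκ y => cj_refl_apply_inv_mul W (hT' w κ hκ) y
  have hK'' : ∀ κ ∈ K, ∀ y, RTF.cj (RTF.refl f₁) (κ⁻¹ * y) = RTF.cj (RTF.refl f₁) y := by
    intro κ hκ y
    have := cj_refl_apply_inv_mul W (f := f₁) (κ := κ) (c := 1) (fun z => by rw [hK κ hκ z, map_one, one_mul]) y
    rw [this, one_mul]
  refine rightRegular_cj_conj_eq_zero_of_orthogonal W R μ DG fdG compG compT compT' hUinv h₁
    (Vτ := (kTypeSpace' W q g g' eP' eM' K (Submodule.span ℂ U) : Set (GA W → ℂ))) ?_ hψ hperp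
  intro ψ' hψ'
  exact rightRegular_mem_kTypeSpace' W R μ DG fdG compG compT compT' q g g' eP' eM' K _ hVspan hf' hT'' hK''
    (Submodule.subset_span hψ')

end Clause

end Summit.Ventures.HodgeRepro.Tier4.Line4

end
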